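import Mathlib.MeasureTheory.Group.Integral
import Literature.NumberTheory.LFunctions.WeilExplicit
import HarnessLib

/-!
# Weil explicit formula: discharged transform API and the easy half of Weil's criterion

Sibling proof file of `Literature/NumberTheory/LFunctions/WeilExplicit.lean` (same normalisation:
`ĝ(s) = ∫ g(t) e^{(s - 1/2)t} dt`, `g̃(t) = conj g(-t)`, `Q(g) = W(g ⋆ g̃)`).

## What is proved here

* `weilMellin_weilReflect_holds` discharges the named fact `Literature.NumberTheory.LFunctions.weilMellin_weilReflect`:
  `(g̃)^(s) = conj ĝ(1 - conj s)` (substitution `t ↦ -t`; Bombieri 2000 §3,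
  `f̃(s) = g̃(s) · (ḡ)̃(1 - s)` for `f = g * ḡ*`).
* `weilMellin_weilConv_holds` discharges the named fact `Literature.NumberTheory.LFunctions.weilMellin_weilConv`:
  `(g ⋆ h)^(s) = ĝ(s) ĥ(s)` for continuous compactly supported `g, h` (write
  `e^{ct} = e^{cu} e^{c(t-u)}` and apply `MeasureTheory.integral_convolution`).
* `weilMellin_weilQuadratic`: `(g ⋆ g̃)^(s) = ĝ(s) · conj ĝ(1 - conj s)` for test functions `g`.
* `weilQuadratic_im_holds` discharges the named fact `Literature.NumberTheory.LFunctions.weilQuadratic_im`: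
  `Im Q(g) = Im W(g ⋆ g̃) = 0`. The kernel `k = g ⋆ g̃` is self-adjoint, `conj k(-t) = k(t)`
  (`conj_weilConv_weilReflect_neg`), hence `conj k̂(s) = k̂(1 - conj s)`
  (`conj_weilMellin_of_selfAdjoint`) and each of the three terms of `W(k)` is self-conjugate
  (`conj_weilFunctional_of_selfAdjoint`); Bombieri 2000 §§2–3 (`f * f̄*` and its transform
  `g̃(s) (ḡ)̃(1 - s)`), Yoshida 1992 §2 (the form is hermitian).
* `WeilPositivity.of_riemannHypothesis`: **the easy half of Weil's criterion**, exactly as printed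
  in E. Bombieri, *Remarks on Weil's quadratic functional in the theory of prime numbers I*,
  Rend. Mat. Acc. Lincei (9) 11 (2000), §3, proof of Theorem 1, eq. (3.2): "The Riemann Hypothesis
  is the statement that `1 - ρ = ρ̄` for every non-trivial zero `ρ` of `ζ(s)`. Thus on the Riemann
  Hypothesis we have `Σ_ρ g̃(ρ) (ḡ)̃(1-ρ) = Σ_ρ g̃(ρ) conj g̃(ρ) = Σ_ρ |g̃(ρ)|² ≥ 0`." Combined with
  the explicit formula (Bombieri 2000 Thm 2; here the NAMED FACT `Literature.NumberTheory.LFunctions.explicit_formula`, taken as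
  a hypothesis) this gives `RiemannHypothesis → WeilPositivity`, i.e. the direction `→` of the
  named fact `Literature.NumberTheory.LFunctions.weil_criterion` (`RHConditionalFacts.lean`) modulo `explicit_formula`.

## What is NOT proved here (and must never be asserted)

`Literature.NumberTheory.LFunctions.WeilPositivity` itself. By Weil's criterion (Weil 1952; Bombieri 2000 Thms 1–2: "the Riemann
Hypothesis is equivalent to the statement that `T[f * f̄*] ≥ 0` on `C₀^∞((0, ∞))`") it is
EQUIVALENT to the Riemann hypothesis; it is a definition of an open property (the thesis of route
`RiemannHypothesis/WeilPos`), not a published theorem, and there is no `WeilPositivity_holds`.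

## References

* A. Weil, *Sur les "formules explicites" de la théorie des nombres premiers*, Comm. Sém. Math.
  Univ. Lund (1952), 252–265.
* E. Bombieri, *Remarks on Weil's quadratic functional in the theory of prime numbers I*,
  Rend. Mat. Acc. Lincei (9) 11 (2000), 183–233, §3 Theorem 1 (eq. (3.2)) and Theorem 2.
-/

noncomputable section

open Complex Filter Set MeasureTheory
open scoped Real Topology Convolution ComplexConjugate

namespace Literature.NumberTheory.LFunctions

/-! ## Discharge of the transform API facts -/

/-- **Discharge of `weilMellin_weilReflect`**: `(g̃)^(s) = conj ĝ(1 - conj s)` for every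
`g : ℝ → ℂ` and `s : ℂ`, by the substitution `t ↦ -t` (`integral_neg_eq_self`) and
`integral_conj`; no hypotheses (both sides are `0` when the integrals diverge).
(Bombieri 2000 §3: `f̃(s) = g̃(s) (ḡ)̃(1 - s)` for `f = g * ḡ*`.) [cite: Bombieri2000, §3] -/
theorem weilMellin_weilReflect_holds : weilMellin_weilReflect := by
  intro g s
  unfold weilMellin weilReflect
  have h := integral_neg_eq_self
    (fun t : ℝ ↦ conj (g t) * cexp ((s - 1 / 2) * ((-t : ℝ) : ℂ))) volume
  simp only [neg_neg] at h
  rw [h, ← integral_conj]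
  congr 1 with t
  rw [map_mul, ← Complex.exp_conj]
  congr 2
  simp only [map_mul, map_sub, map_one, map_div₀, map_ofNat, Complex.conj_conj,
    Complex.conj_ofReal, Complex.ofReal_neg]
  ring

/-- **Discharge of `weilMellin_weilConv`**: `(g ⋆ h)^(s) = ĝ(s) ĥ(s)` for continuous compactly
supported `g, h`. Proof: with `c = s - 1/2`, `(g ⋆ h)(t) e^{ct} = ((g e^{c·}) ⋆ (h e^{c·}))(t)`
pointwise (`e^{ct} = e^{cu} e^{c(t-u)}`), and `∫ (G ⋆ H) = (∫ G)(∫ H)` for integrable `G, H`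
(`MeasureTheory.integral_convolution`, Fubini). (Bombieri 2000 §3.) [cite: Bombieri2000, §3] -/
theorem weilMellin_weilConv_holds : weilMellin_weilConv := by
  intro g h hg hg' hh hh' s
  set c : ℂ := s - 1 / 2 with hc
  set G : ℝ → ℂ := fun u ↦ g u * cexp (c * u) with hG
  set H : ℝ → ℂ := fun u ↦ h u * cexp (c * u) with hH
  have hGi : Integrable G :=
    (hg.mul (by fun_prop)).integrable_of_hasCompactSupport hg'.mul_right
  have hHi : Integrable H :=
    (hh.mul (by fun_prop)).integrable_of_hasCompactSupport hh'.mul_right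
  have key : ∀ t : ℝ, weilConv g h t * cexp (c * t) = (G ⋆[ContinuousLinearMap.mul ℂ ℂ] H) t := by
    intro t
    rw [weilConv_apply, convolution_def, ← integral_mul_const]
    congr 1 with u
    simp only [hG, hH, ContinuousLinearMap.mul_apply']
    have he : cexp (c * t) = cexp (c * u) * cexp (c * ((t - u : ℝ) : ℂ)) := by
      rw [← Complex.exp_add]
      push_cast
      ring_nf
    rw [he]
    ring
  have hL : weilMellin (weilConv g h) s = ∫ t : ℝ, (G ⋆[ContinuousLinearMap.mul ℂ ℂ] H) t := by
    unfold weilMellin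
    exact integral_congr_ae (Eventually.of_forall fun t ↦ key t)
  rw [hL, integral_convolution (ContinuousLinearMap.mul ℂ ℂ) hGi hHi, ContinuousLinearMap.mul_apply']
  rfl

/-- The transform of `g ⋆ g̃` for a test function `g`:
`(g ⋆ g̃)^(s) = ĝ(s) · conj ĝ(1 - conj s)` (Bombieri 2000 §3, `f̃(s) = g̃(s) (ḡ)̃(1-s)` for
`f = g * ḡ*`, in the additive `1/2`-symmetric normalisation). [cite: Bombieri2000, §3] -/
theorem weilMellin_weilQuadratic {g : ℝ → ℂ} (hg : IsWeilTest g) (s : ℂ) :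
    weilMellin (weilConv g (weilReflect g)) s =
      weilMellin g s * conj (weilMellin g (1 - conj s)) := by
  rw [weilMellin_weilConv_holds hg.1.continuous hg.2 hg.weilReflect.1.continuous hg.weilReflect.2,
    weilMellin_weilReflect_holds]

/-- On the critical line the transform of `g ⋆ g̃` is a squared modulus: if `Re ρ = 1/2` then
`(g ⋆ g̃)^(ρ) = ĝ(ρ) conj ĝ(ρ) = |ĝ(ρ)|²` (Bombieri 2000 §3, (3.2)). [cite: Bombieri2000, §3 eq. (3.2)] -/
theorem weilMellin_weilQuadratic_of_re_eq {g : ℝ → ℂ} (hg : IsWeilTest g) {ρ : ℂ}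
    (hρ : ρ.re = 1 / 2) :
    weilMellin (weilConv g (weilReflect g)) ρ = (Complex.normSq (weilMellin g ρ) : ℂ) := by
  have h1 : 1 - conj ρ = ρ := by
    apply Complex.ext
    · simp only [sub_re, one_re, conj_re, hρ]; norm_num
    · simp
  rw [weilMellin_weilQuadratic hg, h1, Complex.mul_conj]

/-! ## The easy half of Weil's criterion -/

/-- Under the Riemann hypothesis every truncated zero side of the explicit formula for `g ⋆ g̃`
has non-negative real part: each index `ρ ∈ weilZeroIndex T` is a zero with `Im ρ ≠ 0`, hence
non-trivial and `≠ 1`, so `Re ρ = 1/2`, `(g ⋆ g̃)^(ρ) = |ĝ(ρ)|²`, and `m(ρ) ≥ 0`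
(`riemannZetaZeroOrder_nonneg`). (Bombieri 2000 §3, (3.2).) [cite: Bombieri2000, §3 eq. (3.2)] -/
theorem weilZeroSidePartial_weilQuadratic_re_nonneg (hRH : RiemannHypothesis) {g : ℝ → ℂ}
    (hg : IsWeilTest g) (T : ℝ) :
    0 ≤ (weilZeroSidePartial (weilConv g (weilReflect g)) T).re := by
  unfold weilZeroSidePartial
  refine finsum_mem_induction (fun z : ℂ ↦ 0 ≤ z.re) (by simp)
    (fun x y hx hy ↦ by simpa only [add_re] using add_nonneg hx hy) ?_
  rintro ρ ⟨hζ, -, -, him, -⟩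
  have hne : ρ ≠ 1 := by
    rintro rfl
    simp at him
  have hre : ρ.re = 1 / 2 := by
    refine hRH ρ hζ ?_ hne
    rintro ⟨n, rfl⟩
    simp at him
  rw [weilMellin_weilQuadratic_of_re_eq hg hre, ← Complex.ofReal_intCast, ← Complex.ofReal_mul,
    Complex.ofReal_re]
  exact mul_nonneg (by exact_mod_cast riemannZetaZeroOrder_nonneg hne) (Complex.normSq_nonneg _)

/-- **The easy half of Weil's criterion** (Weil 1952; Bombieri 2000 §3, proof of Theorem 1,
eq. (3.2): "on the Riemann Hypothesis we have `Σ_ρ g̃(ρ) (ḡ)̃(1-ρ) = Σ_ρ |g̃(ρ)|² ≥ 0`"), modulo the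
Guinand–Weil explicit formula taken as the named fact `Literature.NumberTheory.LFunctions.explicit_formula` (Bombieri 2000 Thm 2):
if the Riemann hypothesis holds then `Re W(g ⋆ g̃) ≥ 0` for every smooth compactly supported `g`,
i.e. `WeilPositivity`. Proof: `W(g ⋆ g̃)` is the limit `T → ∞` of the truncated zero sides
(`explicit_formula`), each of which has non-negative real part under RH
(`weilZeroSidePartial_weilQuadratic_re_nonneg`). This is the direction `→` of the named fact
`Literature.NumberTheory.LFunctions.weil_criterion`; the converse (positivity ⇒ RH) is the deep half and is NOT proved here. [cite: Bombieri2000, §3 Thm 1 eq. (3.2)] -/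
theorem WeilPositivity.of_riemannHypothesis (hEF : explicit_formula) (hRH : RiemannHypothesis) :
    WeilPositivity := by
  intro g hg
  have hk : IsWeilTest (weilConv g (weilReflect g)) := hg.weilConv hg.weilReflect
  have hlim : Tendsto (fun T ↦ (weilZeroSidePartial (weilConv g (weilReflect g)) T).re) atTop
      (𝓝 (weilQuadratic g).re) :=
    (Complex.continuous_re.tendsto _).comp (hEF hk)
  exact ge_of_tendsto' hlim fun T ↦ weilZeroSidePartial_weilQuadratic_re_nonneg hRH hg T

/-- Under RH (and the explicit formula) Weil positivity holds on every truncated cone `K_a`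
(`WeilPositivityOn a`, the `∀`-form used by the route statements). [cite: Bombieri2000, §3 Thm 1 eq. (3.2)] -/
theorem WeilPositivityOn.of_riemannHypothesis (hEF : explicit_formula) (hRH : RiemannHypothesis)
    (a : ℝ) : WeilPositivityOn a :=
  fun g hg _ ↦ WeilPositivity.of_riemannHypothesis hEF hRH g hg

/-! ## Reality of the quadratic functional (`weilQuadratic_im_holds`)

Bombieri (2000, §§2–3): with the involution `f*(x) = conj f(1/x) / x` (here `g̃(t) = conj g(-t)`)
the kernel `k = g ⋆ g̃` (`f * f̄*`) satisfies `k̃ = k`; consequently `conj k̂(s) = k̂(1 - conj s)`, so that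
`k̂(0) = conj k̂(1)`, `k̂` is real on the critical line, `k(0)` is real and
`k(log n) + k(-log n) = 2 Re k(log n)`.  Each of the three terms of `W(k)` is therefore
self-conjugate and `Q(g) = W(g ⋆ g̃)` is real.  All identities below are hypothesis-free: the
substitutions `u ↦ u - t`, `t ↦ -t` and complex conjugation commute with the Bochner integral and
with `tsum` unconditionally (both sides being the junk value `0` together). -/

section Reality

/-- `k = g ⋆ g̃` is self-adjoint for the involution: `conj (k (-t)) = k t`, i.e. `k̃ = k`
(change of variables `u ↦ u - t`; Bombieri 2000 §§2–3, the kernel `f * f̄*`). No hypotheses on `g`.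
[cite: Bombieri2000, §§2–3] -/
theorem conj_weilConv_weilReflect_neg (g : ℝ → ℂ) (t : ℝ) :
    conj (weilConv g (weilReflect g) (-t)) = weilConv g (weilReflect g) t := by
  rw [weilConv_apply, weilConv_apply, ← integral_conj,
    ← integral_sub_right_eq_self (fun u : ℝ ↦ conj (g u * weilReflect g (-t - u))) t]
  refine integral_congr_ae (Eventually.of_forall fun u ↦ ?_)
  have h1 : -(-t - (u - t)) = u := by ring
  have h2 : -(t - u) = u - t := by ring
  simp only [weilReflect, map_mul, Complex.conj_conj, h1, h2]
  exact mul_comm _ _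

/-- For a self-adjoint `k` (`conj (k (-t)) = k t`), `conj k̂(s) = k̂(1 - conj s)` (substitute
`t ↦ -t`; Bombieri 2000 §3, `f̃(s) = g̃(s) (ḡ)̃(1 - s)` for `f = g * ḡ*`; compare
`weilMellin_weilReflect_holds`). [cite: Bombieri2000, §3] -/
theorem conj_weilMellin_of_selfAdjoint {k : ℝ → ℂ} (hk : ∀ t, conj (k (-t)) = k t) (s : ℂ) :
    conj (weilMellin k s) = weilMellin k (1 - conj s) := by
  calc conj (weilMellin k s)
      = ∫ t : ℝ, conj (k t) * cexp ((conj s - 1 / 2) * t) := by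
        rw [weilMellin, ← integral_conj]
        refine integral_congr_ae (Eventually.of_forall fun t ↦ ?_)
        simp only [map_mul, ← Complex.exp_conj, map_sub, map_div₀, map_one, map_ofNat,
          Complex.conj_ofReal]
    _ = ∫ t : ℝ, conj (k (-t)) * cexp ((conj s - 1 / 2) * ((-t : ℝ) : ℂ)) :=
        (integral_neg_eq_self (fun t : ℝ ↦ conj (k t) * cexp ((conj s - 1 / 2) * t)) volume).symm
    _ = weilMellin k (1 - conj s) := by
        rw [weilMellin]
        refine integral_congr_ae (Eventually.of_forall fun t ↦ ?_)
        simp only [hk t, Complex.ofReal_neg]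
        congr 2
        ring

/-- For a self-adjoint `k`, every term of `W(k)` is self-conjugate, hence `conj W(k) = W(k)`:
the polar term is `k̂(0) + conj k̂(0)`, the prime term has self-conjugate summands
`Λ(n) n^{-1/2} (k(log n) + conj k(log n))`, the archimedean integrand
`k̂(1/2 + it) Re ψ(1/4 + it/2)` is real, and `k(0)` is real (Bombieri 2000 §§2–3; Yoshida 1992 §2,
the form is hermitian). [cite: Bombieri2000, §§2–3] -/
theorem conj_weilFunctional_of_selfAdjoint {k : ℝ → ℂ} (hk : ∀ t, conj (k (-t)) = k t) :
    conj (weilFunctional k) = weilFunctional k := by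
  have hM := conj_weilMellin_of_selfAdjoint hk
  have hk' : ∀ t, conj (k t) = k (-t) := fun t ↦ by simpa using hk (-t)
  have h0 : conj (k 0) = k 0 := by simpa using hk 0
  have hP : conj (weilPolarTerm k) = weilPolarTerm k := by
    rw [weilPolarTerm, map_add, hM, hM, map_zero, map_one, sub_zero, sub_self, add_comm]
  have hΛ : conj (weilPrimeTerm k) = weilPrimeTerm k := by
    rw [weilPrimeTerm, Complex.conj_tsum]
    refine tsum_congr fun n ↦ ?_
    rw [map_mul, map_div₀, Complex.conj_ofReal, Complex.conj_ofReal, map_add, hk', hk', neg_neg,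
      add_comm]
  have hA : conj (weilArchTerm k) = weilArchTerm k := by
    rw [weilArchTerm, map_sub, map_mul, map_mul, h0, Complex.conj_ofReal, weilArchIntegral,
      ← integral_conj]
    congr 2
    · rw [map_div₀, map_one, map_mul, map_ofNat, Complex.conj_ofReal]
    · refine integral_congr_ae (Eventually.of_forall fun t ↦ ?_)
      dsimp only
      rw [map_mul, Complex.conj_ofReal, hM]
      congr 2
      rw [map_add, map_mul, Complex.conj_ofReal, Complex.conj_I, map_div₀, map_one, map_ofNat]
      ring
  rw [weilFunctional, map_add, map_sub, hP, hΛ, hA]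

/-- **Discharge of `weilQuadratic_im`.** The quadratic functional is real,
`Im W(g ⋆ g̃) = 0`: `k = g ⋆ g̃` is self-adjoint (`conj_weilConv_weilReflect_neg`), so `W(k)` is
self-conjugate (`conj_weilFunctional_of_selfAdjoint`). The smoothness/support hypothesis is not
needed. (Bombieri 2000 §2; Yoshida 1992.) [cite: Bombieri2000, §2] -/
theorem weilQuadratic_im_holds : weilQuadratic_im := fun {g} _ ↦
  Complex.conj_eq_iff_im.1
    (conj_weilFunctional_of_selfAdjoint (conj_weilConv_weilReflect_neg g))

end Reality

end Literature.NumberTheory.LFunctions
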